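import Mathlib
import Literature.AlgebraicGeometry.Resolution.PointBlowupFlagShiftBound
import Literature.AlgebraicGeometry.Resolution.PointBlowupFlagTangentBound
import Literature.NumberTheory.EllipticCurves.FormalGroupLaw
import Summits.ResolutionOfSingularities.ResolutionOfSingularities.Theorems.WeightedInvariantLocalWeightedDropWildPurePowerFlagBasic

/-!
# `WeightedInvariant.LocalWeightedDrop`, line `hasse-ridge-face-selection`, piece S3πM: bounds on the tangent flags — `d_𝓕 ≤ ord B`,
# and `d_𝓕 = 0` for every flag of large tangency

Crux item stmt-ResolutionOfSingularities-8899 `LocalWeightedDrop` (route `ResolutionOfSingularities/WeightedInvariant`), serving the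
door `WeightedConstruction` stmt-ResolutionOfSingularities-0571.  [OURS · L1 W4.3, chain w43, stub worker 1 (gen 3); the `(d, n)`-side of
[Hauser–Perlega, PRIMS 60 (2024), Prop. 3 p. 791–792] for the game-side flag invariant `PurePowerFlag`; not a statement of any manuscript.]

For a clean non-zero `B ∈ k[[x,y]]` of order `m` and a shift `h ≠ 0`, `h(0) = 0`, of order `n`:
* `dcurv_le_order` / `dFlag_le_order`: `d^curv_𝓕 ≤ m`, `d_𝓕 ≤ m` — the cleaned expansion keeps a clean term of degree `m`
  (`cleanShift_rows_exists_degree_eq`), whose weight is `≤ n·m`, so the weighted initial form has `y`-degree `≤ m`;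
* `dFlag_eq_zero_of_le_tangency`: "there exists a number N such that in_{ω_n}(F) is, up to a constant, a monomial in x and y
  for all n ≥ N.  By Lemma 2 … d_𝓕 > 0 implies n_𝓕 < N" (p. 792 l. 4–8): with `N = a₀ + 1`, where `x^{a₀} y^{b₀}` is the first
  monomial of the lowest row `b₀` of `B`, for `n ≥ N` the weight-`(1,n)` initial form of `B` is `c·x^{a₀}y^{b₀}`, the expansion along
  the flag has initial form `clean(c·x^{a₀}(y + t xⁿ)^{b₀})`, and the univariate Lemma 2 (`exists_coeff_taylor_clean` with `D = β`)
  gives a surviving term of `y`-degree `≤ p^{e−1}` (`= 0` when `q ∤ ord_ω`), whence `d_𝓕 = 0`.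
-/

set_option linter.dupNamespace false -- mandated namespace of this single-conjunct summit

namespace Summit.ResolutionOfSingularities.ResolutionOfSingularities.Theorems

open Literature.AlgebraicGeometry.Resolution
open Literature.AlgebraicGeometry.Resolution.HauserPerlega2024

namespace PurePowerFlag

open MvPowerSeries

variable {k : Type} [Field k]

/-! ### Two letters -/

/-- Every letter of `Fin 2` is `0` or `1`. -/
theorem letter_cases (l : Fin 2) : l = (0 : Fin 2) ∨ l = 1 := by
  fin_cases l
  · exact Or.inl rfl
  · exact Or.inr rfl

/-- The weight `ω(x) = 1, ω(y) = n` of a plane exponent. -/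
theorem weight_weights (n : ℕ) (d : Fin 2 →₀ ℕ) : Finsupp.weight (weights n) d = d 0 + n * d 1 := by
  rw [Finsupp.weight_apply, Finsupp.sum_fintype _ _ (fun i => by simp), Fin.sum_univ_two]
  simp [weights, mul_comm]

/-! ### The expansion keeps the order -/

/-- A clean term of degree `ord B` survives in every cleaned expansion. [HP24 Lemma 3 proof p. 791 l. 10–12] -/
theorem exists_coeff_expansion_degree_eq (p : ℕ) [Fact p.Prime] [CharP k p] (e : ℕ) {B : MvPowerSeries (Fin 2) k}
    (hB : B ≠ 0) (hclean : cleanSeries (p ^ e) B = B) (h : PowerSeries k) (h0 : PowerSeries.constantCoeff h = 0) :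
    ∃ d : Fin 2 →₀ ℕ, coeff d (expansion (p ^ e) B h) ≠ 0 ∧ d 0 + d 1 = B.order.toNat := by
  classical
  set R : ℕ → PowerSeries k := fun j => PowerSeries.mk fun v =>
    coeff (Finsupp.single 0 (0 + v) + Finsupp.single 1 j) (expansion (p ^ e) B h) with hRdef
  have hR : ∀ j v, PowerSeries.coeff v (R j) = coeff (Finsupp.single 0 (0 + v) + Finsupp.single 1 j)
      (cleanSeries (p ^ e) (subst (fun l => if l = (1 : Fin 2) then
        (X (1 : Fin 2) : MvPowerSeries (Fin 2) k) + PowerSeries.subst (X (0 : Fin 2) : MvPowerSeries (Fin 2) k) h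
        else X l) B)) := fun j v => by
    rw [hRdef, PowerSeries.coeff_mk]; rfl
  obtain ⟨d₀, hd₀, hdeg₀⟩ := exists_coeff_ne_zero_degree_eq_order hB
  obtain ⟨i, a, hia, hsum⟩ := cleanShift_rows_exists_degree_eq p e (0 : Fin 2) 1 (by decide) letter_cases B 0
    B.order.toNat (fun m _ => Nat.zero_le _) (fun m hm => by rw [zero_add]; exact order_toNat_le_degree hm)
    ⟨d₀, by rw [hclean]; exact hd₀, by rw [zero_add]; exact hdeg₀⟩ h h0 R hR
  refine ⟨Finsupp.single 0 a + Finsupp.single 1 i, ?_, ?_⟩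
  · have := hia
    rw [hRdef, PowerSeries.coeff_mk, zero_add] at this
    exact this
  · simp only [Finsupp.coe_add, Pi.add_apply, Finsupp.single_eq_same, Finsupp.single_eq_of_ne (show (0 : Fin 2) ≠ 1 by decide),
      Finsupp.single_eq_of_ne (show (1 : Fin 2) ≠ 0 by decide), add_zero, zero_add]
    omega

/-- The expansion along a flag of a clean non-zero coefficient is non-zero. -/
theorem expansion_ne_zero (p : ℕ) [Fact p.Prime] [CharP k p] (e : ℕ) {B : MvPowerSeries (Fin 2) k}
    (hB : B ≠ 0) (hclean : cleanSeries (p ^ e) B = B) (h : PowerSeries k) (h0 : PowerSeries.constantCoeff h = 0) :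
    expansion (p ^ e) B h ≠ 0 := by
  obtain ⟨d, hd, -⟩ := exists_coeff_expansion_degree_eq p e hB hclean h h0
  intro h0'
  rw [h0', map_zero] at hd
  exact hd rfl

/-! ### `d_𝓕 ≤ ord B` -/

/-- `d^curv_𝓕 ≤ ord B` for every flag with `h ≠ 0` (so of tangency `n ≥ 1`). [bookkeeping for HP24 Prop. 3: "d_𝓕 is bounded"] -/
theorem dcurv_le_order (p : ℕ) [Fact p.Prime] [CharP k p] (e : ℕ) {B : MvPowerSeries (Fin 2) k}
    (hB : B ≠ 0) (hclean : cleanSeries (p ^ e) B = B) (h : PowerSeries k) (h0 : PowerSeries.constantCoeff h = 0)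
    {n : ℕ} (hn : 1 ≤ n) :
    dcurv (p ^ e) B h n ≤ (B.order.toNat : ℕ∞) := by
  set C := expansion (p ^ e) B h with hC
  obtain ⟨d₁, hd₁, hdeg₁⟩ := exists_coeff_expansion_degree_eq p e hB hclean h h0
  -- the weighted order is at most `n · ord B`
  have hW : wOrder (weights n) C ≤ ((n * B.order.toNat : ℕ) : ℕ∞) := by
    refine le_trans (weightedOrder_le (weights n) hd₁ : wOrder (weights n) C ≤ _) ?_
    rw [weight_weights]
    exact_mod_cast (by nlinarith : d₁ 0 + n * d₁ 1 ≤ n * B.order.toNat)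
  have hCne : C ≠ 0 := expansion_ne_zero p e hB hclean h h0
  have hWfin : wOrder (weights n) C ≠ ⊤ := ne_top_of_le_ne_top (ENat.coe_ne_top _) hW
  obtain ⟨W, hWeq⟩ := ENat.ne_top_iff_exists.mp hWfin
  obtain ⟨⟨d₂, hd₂, hwd₂⟩, -⟩ := (weightedOrder_eq_nat (w := weights n) (f := C)).mp hWeq.symm
  -- `d₂` lies in the initial part
  have hinit : coeff d₂ (initialPart (weights n) C) ≠ 0 := by
    rw [coeff_initialPart_ne_zero_iff]
    exact ⟨hd₂, by rw [hwd₂]; exact hWeq⟩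
  refine le_trans (ordAlong_le 1 hinit) ?_
  have h2 : ((d₂ 0 + n * d₂ 1 : ℕ) : ℕ∞) ≤ ((n * B.order.toNat : ℕ) : ℕ∞) := by
    rw [← weight_weights, hwd₂, hWeq]; exact hW
  have h3 : d₂ 0 + n * d₂ 1 ≤ n * B.order.toNat := by exact_mod_cast h2
  exact_mod_cast (by nlinarith : d₂ 1 ≤ B.order.toNat)

/-- `d_𝓕 ≤ ord B`. -/
theorem dFlag_le_order (p : ℕ) [Fact p.Prime] [CharP k p] (e : ℕ) {B : MvPowerSeries (Fin 2) k}
    (hB : B ≠ 0) (hclean : cleanSeries (p ^ e) B = B) (h : PowerSeries k) (h0 : PowerSeries.constantCoeff h = 0)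
    {n : ℕ} (hn : 1 ≤ n) :
    dFlag (p ^ e) B h n ≤ B.order.toNat := by
  have hdc : (dcurv (p ^ e) B h n).toNat ≤ B.order.toNat := by
    have h1 := dcurv_le_order p e hB hclean h h0 hn
    have hfin : dcurv (p ^ e) B h n ≠ ⊤ := ne_top_of_le_ne_top (ENat.coe_ne_top _) h1
    rw [← ENat.coe_toNat hfin] at h1
    exact_mod_cast h1
  unfold dFlag
  split_ifs
  · exact Nat.zero_le _
  · exact hdc

/-! ### Large tangency: `d_𝓕 = 0` -/

/-- The lowest row `b₀ = ord_y B` and its first monomial `x^{a₀} y^{b₀}`: every other monomial of `B` has LARGER weight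
`a + n b` as soon as `n > a₀`. [HP24 Prop. 3 proof p. 792 l. 4–6: "in_{ω_n}(F) is, up to a constant, a monomial in x and y for all n ≥ N"] -/
theorem weight_lt_of_ne_corner {B : MvPowerSeries (Fin 2) k} {a₀ b₀ : ℕ} (hb₀ : ordAlong (1 : Fin 2) B = (b₀ : ℕ∞))
    (ha₀ : rowOrder (0 : Fin 2) 1 B b₀ = (a₀ : ℕ∞)) {n : ℕ} (hn : a₀ < n) {d : Fin 2 →₀ ℕ} (hd : coeff d B ≠ 0) :
    a₀ + n * b₀ ≤ d 0 + n * d 1 ∧ (a₀ + n * b₀ = d 0 + n * d 1 → d = Finsupp.single 0 a₀ + Finsupp.single 1 b₀) := by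
  have hb : b₀ ≤ d 1 := by
    have := ordAlong_le (1 : Fin 2) hd
    rw [hb₀] at this
    exact_mod_cast this
  rcases hb.lt_or_eq with hlt | heq
  · have h1 : n * b₀ + n ≤ n * d 1 := by
      have := Nat.mul_le_mul_left n hlt
      rw [Nat.mul_succ] at this
      exact this
    constructor
    · omega
    · intro h; exfalso; omega
  · -- on the lowest row, `a₀` is the least `x`-exponent
    have ha : a₀ ≤ d 0 := by
      have h1 : rowOrder (0 : Fin 2) 1 B b₀ ≤ (d 0 : ℕ∞) := by
        refine iInf₂_le (d 0) ?_
        rw [heq, ← Literature.NumberTheory.EllipticCurves.finsupp_fin_two_eq d]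
        exact hd
      rw [ha₀] at h1
      exact_mod_cast h1
    rw [heq]
    constructor
    · omega
    · intro h
      have : d 0 = a₀ := by omega
      conv_lhs => rw [Literature.NumberTheory.EllipticCurves.finsupp_fin_two_eq d, this]

/-- **`d_𝓕 = 0` FOR EVERY FLAG OF LARGE TANGENCY.**  For a clean non-zero `B` there is `N` such that every shift `h` with
`h(0) = 0` and `ord h ≥ N` has `dFlag q B h (ord h) = 0`. [HP24 Prop. 3 proof p. 792 l. 4–8; Lemma 2 p. 789 ("if ord H = 0, then d_𝓕 = 0")] -/
theorem exists_bound_dFlag_eq_zero (p : ℕ) [Fact p.Prime] [CharP k p] (e : ℕ) {B : MvPowerSeries (Fin 2) k}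
    (hB : B ≠ 0) (hclean : cleanSeries (p ^ e) B = B) :
    ∃ N : ℕ, ∀ (h : PowerSeries k), PowerSeries.constantCoeff h = 0 → h ≠ 0 → N ≤ tangency h →
      dFlag (p ^ e) B h (tangency h) = 0 := by
  classical
  set q := p ^ e with hq
  -- the corner `x^{a₀} y^{b₀}`
  obtain ⟨db, hdb, hb₀⟩ := exists_coeff_ne_zero_ordAlong (1 : Fin 2) hB
  set b₀ := db 1 with hb₀def
  have hrow : rowOrder (0 : Fin 2) 1 B b₀ ≠ ⊤ := by
    refine ne_top_of_le_ne_top (ENat.coe_ne_top (db 0)) (iInf₂_le (db 0) ?_)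
    rw [← Literature.NumberTheory.EllipticCurves.finsupp_fin_two_eq db]; exact hdb
  obtain ⟨a₀, ha₀⟩ := ENat.ne_top_iff_exists.mp hrow
  have ha₀' : rowOrder (0 : Fin 2) 1 B b₀ = (a₀ : ℕ∞) := ha₀.symm
  -- the corner coefficient is non-zero and the corner is not in `q·ℕ²`
  set c₀ : Fin 2 →₀ ℕ := Finsupp.single 0 a₀ + Finsupp.single 1 b₀ with hc₀
  have hc₀0 : c₀ 0 = a₀ := by simp [hc₀]
  have hc₀1 : c₀ 1 = b₀ := by simp [hc₀]
  have hcorner : coeff c₀ B ≠ 0 := by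
    -- the row infimum is attained
    have hSne : ({a | B (Finsupp.single 0 a + Finsupp.single 1 b₀) ≠ 0} : Set ℕ).Nonempty :=
      ⟨db 0, by
        show B (Finsupp.single 0 (db 0) + Finsupp.single 1 b₀) ≠ 0
        rw [← Literature.NumberTheory.EllipticCurves.finsupp_fin_two_eq db]; exact hdb⟩
    have hmem := Nat.sInf_mem hSne
    have hinf : rowOrder (0 : Fin 2) 1 B b₀ = (sInf {a | B (Finsupp.single 0 a + Finsupp.single 1 b₀) ≠ 0} : ℕ) := by
      apply le_antisymm
      · exact iInf₂_le _ hmem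
      · exact le_iInf₂ fun a ha => by exact_mod_cast Nat.sInf_le ha
    have ha₀eq : a₀ = sInf {a | B (Finsupp.single 0 a + Finsupp.single 1 b₀) ≠ 0} := by
      have := ha₀'; rw [hinf] at this; exact_mod_cast this.symm
    rw [hc₀, ha₀eq]
    exact hmem
  have hcnd : ¬ (q ∣ a₀ ∧ q ∣ b₀) := by
    have h := (coeff_cleanSeries_of_ne_zero q B c₀ (by rw [hclean]; exact hcorner)).2
    intro hh; apply h; intro i
    rcases letter_cases i with rfl | rfl
    · rw [hc₀0]; exact hh.1
    · rw [hc₀1]; exact hh.2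
  refine ⟨a₀ + 1, fun h h0 hne hN => ?_⟩
  set n := tangency h with hndef
  have hn : a₀ < n := hN
  have hnpos : 0 < n := by omega
  -- the order of `h` is `n`, its leading coefficient `t ≠ 0`
  have horder : h.order = (n : ℕ∞) := by
    rw [hndef, tangency]
    exact (ENat.coe_toNat (fun h' => hne (PowerSeries.order_eq_top.mp h'))).symm
  set t := PowerSeries.coeff n h with ht
  have htne : t ≠ 0 := by rw [ht, hndef]; exact PowerSeries.coeff_order hne
  have hlt : ∀ m, m < n → PowerSeries.coeff m h = 0 := fun m hm =>
    PowerSeries.coeff_of_lt_order m (by rw [horder]; exact_mod_cast hm)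
  -- the weight line `w₀ = a₀ + n b₀`
  set w₀ := a₀ + n * b₀ with hw₀
  have hw : ∀ d : Fin 2 →₀ ℕ, coeff d B ≠ 0 → w₀ ≤ d 0 + n * d 1 := fun d hd =>
    (weight_lt_of_ne_corner hb₀ ha₀' hn hd).1
  -- the flattened weight line is the monomial `c · Y^{b₀}`
  set P : Polynomial k := ∑ b ∈ Finset.range (w₀ / n + 1), Polynomial.monomial b
    (coeff (Finsupp.single 0 (w₀ - n * b) + Finsupp.single 1 b) B) with hP
  have hPcoeff : ∀ b, P.coeff b ≠ 0 → b = b₀ := by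
    intro b hb
    rw [hP, Polynomial.finsetSum_coeff] at hb
    obtain ⟨b', hb'mem, hb'⟩ := Finset.exists_ne_zero_of_sum_ne_zero hb
    rw [Polynomial.coeff_monomial] at hb'
    split_ifs at hb' with hbb
    · subst hbb
      have hle : n * b' ≤ w₀ := by
        have := Finset.mem_range.mp hb'mem
        have h1 : b' ≤ w₀ / n := by omega
        calc n * b' ≤ n * (w₀ / n) := Nat.mul_le_mul_left _ h1
          _ ≤ w₀ := Nat.mul_div_le w₀ n
      set d' : Fin 2 →₀ ℕ := Finsupp.single 0 (w₀ - n * b') + Finsupp.single 1 b' with hd'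
      have hd'0 : d' 0 = w₀ - n * b' := by simp [hd']
      have hd'1 : d' 1 = b' := by simp [hd']
      have hwt : a₀ + n * b₀ = d' 0 + n * d' 1 := by rw [hd'0, hd'1]; omega
      have heq := (weight_lt_of_ne_corner hb₀ ha₀' hn hb').2 hwt
      have := congrArg (fun f => f 1) heq
      simpa [hd'] using this
    · exact absurd hb' (not_not.mpr rfl)
  have hb₀mem : b₀ ∈ Finset.range (w₀ / n + 1) := by
    rw [Finset.mem_range]
    have : b₀ ≤ w₀ / n := by
      rw [hw₀]
      calc b₀ = (n * b₀) / n := (Nat.mul_div_cancel_left b₀ hnpos).symm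
        _ ≤ (a₀ + n * b₀) / n := Nat.div_le_div_right (Nat.le_add_left _ _)
    omega
  have hPb₀ : P.coeff b₀ = coeff c₀ B := by
    rw [hP, Polynomial.finsetSum_coeff, Finset.sum_eq_single b₀]
    · rw [Polynomial.coeff_monomial, if_pos rfl, hc₀, hw₀, Nat.add_sub_cancel]
    · intro b _ hb
      rw [Polynomial.coeff_monomial, if_neg hb]
    · intro hb; exact absurd hb₀mem hb
  have hPne : P ≠ 0 := fun h0 => hcorner (by rw [← hPb₀, h0, Polynomial.coeff_zero])
  have hPclean : ∀ b, P.coeff b ≠ 0 → ¬ (p ^ e ∣ b ∧ p ^ e ∣ w₀) := by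
    intro b hb
    rw [hPcoeff b hb]
    rintro ⟨h1, h2⟩
    apply hcnd
    refine ⟨?_, h1⟩
    have h3 : q ∣ n * b₀ := Dvd.dvd.mul_left h1 n
    exact (Nat.dvd_add_right h3).mp (by rw [add_comm]; exact h2)
  have hPβ : ∀ b, P.coeff b ≠ 0 → b₀ ≤ b := fun b hb => (hPcoeff b hb).ge
  have hPD : P.natDegree ≤ b₀ := by
    refine Polynomial.natDegree_le_iff_coeff_eq_zero.mpr fun b hb => ?_
    by_contra hne
    exact absurd (hPcoeff b hne) (by omega)
  obtain ⟨j, hj, hjq, hjle, hj0⟩ := exists_coeff_taylor_clean p hPne htne hPclean hPβ hPD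
  rw [Nat.sub_self, zero_add] at hjle
  -- the corresponding monomial of the cleaned expansion
  have hjb : j ≤ b₀ := by
    by_contra hjb
    apply hj
    apply Polynomial.coeff_eq_zero_of_natDegree_lt
    rw [Polynomial.natDegree_taylor]
    omega
  have hnj : n * j ≤ w₀ := le_trans (Nat.mul_le_mul_left _ hjb) (by rw [hw₀]; omega)
  set dj : Fin 2 →₀ ℕ := Finsupp.single 0 (w₀ - n * j) + Finsupp.single 1 j with hdj
  have hdj0 : dj 0 = w₀ - n * j := by simp [hdj]
  have hdj1 : dj 1 = j := by simp [hdj]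
  have hdjw : dj 0 + n * dj 1 = w₀ := by rw [hdj0, hdj1]; omega
  set C := expansion q B h with hC
  have hsub : ∀ d : Fin 2 →₀ ℕ, d 0 + n * d 1 ≤ w₀ → coeff d (subst (shift h) B) =
      if d 0 + n * d 1 = w₀ then (Polynomial.taylor t P).coeff (d 1) else 0 := fun d hd => by
    rw [shift_eq]
    exact coeff_subst_triangular_of_weight_le (0 : Fin 2) 1 (by decide) letter_cases hnpos hlt ht.symm B hw d hd
  have hCdj : coeff dj C ≠ 0 := by
    rw [hC, expansion, coeff_cleanSeries, if_neg, hsub dj hdjw.le, if_pos hdjw, hdj1]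
    · exact hj
    · intro hall
      apply hjq
      refine ⟨by rw [← hdj1]; exact hall 1, ?_⟩
      have h0' := hall 0
      rw [hdj0] at h0'
      have h1' : q ∣ n * j := Dvd.dvd.mul_left (by rw [← hdj1]; exact hall 1) n
      have := (Nat.dvd_add_right h0').mpr h1'  -- placeholder
      rw [Nat.sub_add_cancel hnj] at this
      exact this
  -- every monomial of the expansion has weight `≥ w₀`, so the weighted order is `w₀`
  have hCw : ∀ d : Fin 2 →₀ ℕ, coeff d C ≠ 0 → w₀ ≤ d 0 + n * d 1 := by
    intro d hd
    by_contra hlt'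
    push Not at hlt'
    have h1 := (coeff_cleanSeries_of_ne_zero q _ d hd).1
    rw [hC, expansion] at hd
    rw [h1, hsub d hlt'.le, if_neg hlt'.ne] at hd
    exact hd rfl
  have hWO : wOrder (weights n) C = (w₀ : ℕ∞) := by
    apply le_antisymm
    · have := weightedOrder_le (w := weights n) hCdj
      rwa [weight_weights, hdjw] at this
    · refine le_weightedOrder (weights n) fun d hd => ?_
      by_contra hne
      rw [weight_weights] at hd
      exact absurd (hCw d hne) (not_le.mpr (by exact_mod_cast hd))
  -- `d^curv ≤ j`
  have hinit : coeff dj (initialPart (weights n) C) ≠ 0 := by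
    rw [coeff_initialPart_ne_zero_iff]
    exact ⟨hCdj, by rw [weight_weights, hdjw, hWO]⟩
  have hdc : dcurv q B h n ≤ (j : ℕ∞) := by
    have := ordAlong_le (1 : Fin 2) hinit
    rwa [hdj1] at this
  have hdcfin : dcurv q B h n ≠ ⊤ := ne_top_of_le_ne_top (ENat.coe_ne_top _) hdc
  have hdcj : (dcurv q B h n).toNat ≤ j := by
    rw [← ENat.coe_toNat hdcfin] at hdc; exact_mod_cast hdc
  -- conclusion
  have hWfl : (wFlag q B h n).toNat = w₀ := by
    show (wOrder (weights n) (expansion q B h)).toNat = w₀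
    rw [← hC, hWO, ENat.toNat_coe]
  have he : 0 < e := by
    by_contra he0
    have he0' : e = 0 := by omega
    apply hcnd
    rw [hq, he0', pow_zero]
    exact ⟨one_dvd _, one_dvd _⟩
  have he1 : p ^ (e - 1) < q := by
    rw [hq]
    exact Nat.pow_lt_pow_right (Fact.out : p.Prime).one_lt (by omega)
  show dFlag q B h n = 0
  unfold dFlag
  split_ifs with hcase
  · rfl
  · push Not at hcase
    by_contra hpos
    have hpos' : 0 < (dcurv q B h n).toNat := Nat.pos_of_ne_zero hpos
    have hltq : (dcurv q B h n).toNat < q := lt_of_le_of_lt (le_trans hdcj hjle) he1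
    have hndvd := hcase hpos' hltq
    rw [hWfl] at hndvd
    have := hj0 hndvd
    omega

end PurePowerFlag

end Summit.ResolutionOfSingularities.ResolutionOfSingularities.Theorems
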